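import Summits.CriticalPhenomena.PercolationContinuityZ3.Theorems.PercNearOneGluingNoHeavyLowerTailSahiAllButC
import Summits.CriticalPhenomena.PercolationContinuityZ3.Theorems.PercNearOneGluingNoHeavyLowerTailSahiCTCN3Five

/-!
# `NoHeavyLowerTail` (crux stmt-CriticalPhenomena-4575), Sahi / Kahn positivity: **KAHN'S CONJECTURE 5 / SAHI'S `C₃` FOR THE FIRST SLOT
# "AT LEAST TWO OF FIVE OPEN"** (`Th₂⁵`, the level-3 threshold event on a block of five coordinates), every interior product measure, all
# increasing `U, V`, every dimension — completing EVERY THRESHOLD FIRST SLOT ON AT MOST FIVE COORDINATES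

Support file (cell `prim-l12`, seat P3, gen 21; `--supports stmt-CriticalPhenomena-4575`; `--computational` through `…SahiCTCN3Five` and one
small `native_decide` here).  Memo `run/shared/lean/prim/prim-l12/FROM-prim-l12-p3-g21-*.md`.

**THEOREM `sahiE_three_nonneg_of_allButThree_five`.**  Let `e : Fin 5 ↪ ι` be a block of a finite product space with parameters in `(0,1)` on
the block, `H` an increasing event determined by the block whose pattern event is `allBut 3 5 = {at most three of the five closed} = {at least two
of the five open}`.  Then `E₃(1_H, 1_U, 1_V) ≥ 0` for ALL increasing `U, V` (Kahn arXiv:2210.08653 Conj. 5 / Sahi 2008 `C₃` for this first slot).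
PROOF = the level-3 threshold certificate: `ρ₃ = μ(· | exactly three closed)` is a reduced transport certificate (`…SahiAllButC.rhoCert_allBut`)
because (a) `(Π+D₃)e₃ − Θ₃D₃ ∈ ℕ[r]` on five variables (`coeff_aPoly3_nonneg`, a 3125-entry table check) and (TC) `Ñ₃(K_𝒳,K_𝒵) ∈ ℕ[r]` for every
pair of complexes on five points (`…SahiCTCN3Five.coeff_Ngen3_nonneg_fin5`, the kernel-checked finite enumeration).
With the tree's earlier theorems the threshold ("at least `t` of `k` open") first slots on `k ≤ 5` coordinates are now ALL settled: `t = k`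
(cylinders: the principal stratum, `…SahiMasterFamilyPrincipalCapC3.sahiE_three_ind_nonneg_of_principal`, Sahi's Thm 2), `t = 1` (hitting
events, `…SahiHittingSlot`), `k ≤ 4` (`…SahiTransportJRFour`), `t = k − 1` (`…SahiAllButOne`), `Th₃⁵` = majority of five (`…SahiAllButTwoFive`),
and `Th₂⁵` (this file).  Nothing is asserted about the crux.
-/

noncomputable section

open scoped Classical

namespace Summit.CriticalPhenomena.PercolationContinuityZ3.Theorems

namespace SahiAllButC

open Finset MvPolynomial
open SahiHittingSlot SahiTransportCert SahiAllButOne SahiAllButTwo SahiCTCForms SahiCTCGenFun SahiCTCForms.N2Five SahiCTCForms.N3Five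
open Literature.Combinatorics.Sahi2008
open Literature.Probability.Percolation (DeterminedBy)
open Literature.Probability.Percolation.DecisionTree (ind)

/-! ### Row (a) in its clean form -/

/-- `Θ_{c+1} = Θ_c + e_{c+1}`. [this work] -/
theorem ThC_succ {α : Type*} [DecidableEq α] [Fintype α] (c : ℕ) : (ThC (c + 1) : MvPolynomial α ℤ) = ThC c + ee (c + 1) := by
  unfold ThC ee bySize
  rw [← gf_union]
  · congr 1; ext C
    simp only [mem_union, mem_filter, mem_powerset, subset_univ, true_and]; omega
  · rw [disjoint_left]; intro C h1 h2
    have := (mem_filter.1 h1).2; have := (mem_filter.1 h2).2; omega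

/-- **Row (a) in its clean form**: `(Π + D_{c+1})·e_{c+1} − Θ_{c+1}·D_{c+1} = Π·e_{c+1} − Θ_c·D_{c+1}`.  Probabilistically (a)_{c+1} says
`P(N ≤ c)·P(N ≥ c+2) ≤ P(N = c+1)` for the number `N` of closed coordinates of the block (memo g21 §1: true for every product measure iff
`c + 1 ≤ 5`; coefficientwise for every `k` at `c + 1 = 2`, `…SahiAllButTwoRowA`). [this work] -/
theorem aPolyC_eq {α : Type*} [DecidableEq α] [Fintype α] (c : ℕ) :
    ((PiP + DdC (c + 1)) * ee (c + 1) - ThC (c + 1) * DdC (c + 1) : MvPolynomial α ℤ) = PiP * ee (c + 1) - ThC c * DdC (c + 1) := by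
  have hPi : (PiP : MvPolynomial α ℤ) = ThC (c + 1) + DdC (c + 1) := by
    unfold PiP ThC DdC bySize
    rw [← gf_union]
    · congr 1; ext C
      simp only [mem_union, mem_filter, mem_powerset, subset_univ, true_and, true_iff]; omega
    · rw [disjoint_left]; intro C h1 h2
      have := (mem_filter.1 h1).2; have := (mem_filter.1 h2).2; omega
  rw [ThC_succ]
  rw [ThC_succ] at hPi
  rw [hPi]; ring

/-! ### Row (a) on five coordinates at level 3: `(Π + D₃)·e₃ − Θ₃·D₃ ∈ ℕ[r]` -/

/-- The table of `(Π + D₃)·e₃ − Θ₃·D₃`. [this work] -/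
def aTab3 : Array ℤ := subTab tabB3 (mulFam (mulFam oneTab dd3C) th3C)

/-- The table check. [this work] -/
theorem aTab3_nonneg : tabNonneg aTab3 = true := by native_decide

/-- `(Π + D₃)·e₃ − Θ₃·D₃` has degree `≤ 4` in each variable (indeed `≤ 2`). [this work] -/
theorem degreeOf_aPoly3_le (i : Fin 5) : degreeOf i ((PiP + DdC 3) * ee 3 - ThC 3 * DdC 3 : MvPolynomial (Fin 5) ℤ) ≤ 4 := by
  have hg : ∀ F : Finset (Finset (Fin 5)), degreeOf i (gf F) ≤ 1 := fun F => degreeOf_gf_le F i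
  have hPi : degreeOf i (PiP : MvPolynomial (Fin 5) ℤ) ≤ 1 := hg _
  have hDd : degreeOf i (DdC 3 : MvPolynomial (Fin 5) ℤ) ≤ 1 := hg _
  have hTh : degreeOf i (ThC 3 : MvPolynomial (Fin 5) ℤ) ≤ 1 := hg _
  have he3 : degreeOf i (ee 3 : MvPolynomial (Fin 5) ℤ) ≤ 1 := hg _
  refine (degreeOf_sub_le i _ _).trans (max_le ?_ ?_)
  · refine (degreeOf_mul_le i _ _).trans ?_
    have := (degreeOf_add_le i (PiP : MvPolynomial (Fin 5) ℤ) (DdC 3)).trans (max_le hPi hDd)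
    omega
  · refine (degreeOf_mul_le i _ _).trans ?_
    omega

/-- **Row (a) coefficientwise on five coordinates at level 3.** [this work] -/
theorem coeff_aPoly3_nonneg (n : Fin 5 →₀ ℕ) : 0 ≤ ((PiP + DdC 3) * ee 3 - ThC 3 * DdC 3 : MvPolynomial (Fin 5) ℤ).coeff n := by
  have key : ∀ f : Fin 5 → Fin 5, aTab3.getD (codeOf f) 0 =
      ((PiP * (ee 3 * 1) + DdC 3 * (ee 3 * 1)) - ThC 3 * (DdC 3 * 1) : MvPolynomial (Fin 5) ℤ).coeff (fsOf f) :=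
    rep_sub (rep_add (rep_mulFam (rep_mulFam rep_one _) _) (rep_mulFam (rep_mulFam rep_one _) _)) (rep_mulFam (rep_mulFam rep_one _) _)
  by_cases hn : ∀ i, n i ≤ 4
  · obtain ⟨f, rfl⟩ := exists_fsOf_of_small hn
    have h := aTab3_nonneg
    rw [tabNonneg, List.all_eq_true] at h
    have := of_decide_eq_true (h (codeOf f) (List.mem_range.2 (codeOf_lt f)))
    rw [key f, show (PiP * (ee 3 * 1) + DdC 3 * (ee 3 * 1) - ThC 3 * (DdC 3 * 1) : MvPolynomial (Fin 5) ℤ) =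
      (PiP + DdC 3) * ee 3 - ThC 3 * DdC 3 by ring] at this
    exact this
  · have h0 : ((PiP + DdC 3) * ee 3 - ThC 3 * DdC 3 : MvPolynomial (Fin 5) ℤ).coeff n = 0 := by
      by_contra h
      exact hn fun i => (degreeOf_le_iff.1 (degreeOf_aPoly3_le i)) n (mem_support_iff.2 h)
    rw [h0]

/-- Row (a) at the odds vector of interior parameters on five coordinates, level 3. [this work] -/
theorem aRow3_five {q : Fin 5 → unitInterval} (hq : ∀ i, 0 < (q i : ℝ) ∧ (q i : ℝ) < 1) :
    ev q (ThC 3) * ev q (DdC 3) ≤ (ev q PiP + ev q (DdC 3)) * ev q (ee 3 : MvPolynomial (Fin 5) ℤ) := by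
  have h := eval_le_of_coeff_le (P := (0 : MvPolynomial (Fin 5) ℤ)) (Q := (PiP + DdC 3) * ee 3 - ThC 3 * DdC 3)
    (fun m => by rw [coeff_zero]; exact coeff_aPoly3_nonneg m) (r q) (r_nonneg hq)
  rw [eval₂_zero, eval₂_sub, eval₂_mul, eval₂_mul, eval₂_add, sub_nonneg] at h
  exact h

/-- **KAHN'S CONJECTURE 5 / SAHI'S `C₃` FOR THE FIRST SLOT "AT LEAST TWO OF FIVE OPEN".**  For a block `e : Fin 5 ↪ ι` with interior parameters,
an increasing event `H` determined by the block with pattern event `allBut 3 5` (at most three of the five coordinates closed, i.e. at least two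
open), and ALL increasing `U, V ⊆ 2^ι`: `E₃(1_H, 1_U, 1_V) ≥ 0`. [this work] -/
theorem sahiE_three_nonneg_of_allButThree_five {ι : Type} [Fintype ι] (p : ι → unitInterval) (e : Fin 5 ↪ ι)
    (hp : ∀ i, 0 < (p (e i) : ℝ) ∧ (p (e i) : ℝ) < 1) {H : Set (Set ι)} (hH : DeterminedBy H (Set.range e))
    (hpat : pat e H = allBut 3 5) {U V : Set (Set ι)} (hU : IsUpperSet U) (hV : IsUpperSet V) :
    0 ≤ sahiE (bernoulliWeight p) 3 ![ind H, ind U, ind V] := by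
  have hq : ∀ i, 0 < (pk e p i : ℝ) ∧ (pk e p i : ℝ) < 1 := hp
  refine sahiE_three_nonneg_of_allBut p e (c := 3) (by norm_num) hp (aRow3_five hq) (fun 𝒳 𝒵 h𝒳 h𝒵 hX hZ => ?_) hH hpat hU hV
  exact eval_Ngen3_nonneg_fin5 (isLowerSet_cx h𝒳) (isLowerSet_cx h𝒵) (empty_mem_cx h𝒳 hX) (empty_mem_cx h𝒵 hZ) _ (r_nonneg hq)

end SahiAllButC

end Summit.CriticalPhenomena.PercolationContinuityZ3.Theorems
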